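import Summits.AtomisticToContinuum.Crystallization.Theorems.ChargedEnergyGapKinkCertB2
import HarnessLib

/-!
# Charged energy gap — KINK CERTIFICATES, file B part 3/4: §S6 the W leaf · §S7 the C leaf · §S8 ★★ soundness of the checker

student team «lens-3» (decomposition, residual mode), generation 84, NODE 85 «KinkCert»; namespace `…Theorems.ChargedEnergyGapChartDial`.
Continuation of `…ChargedEnergyGapKinkCertB` (see its module docstring for the design of the reflected checker `kcCheck` and the plan of the
soundness proof §S1–§S10); this part is the verbatim continuation of the single development, cut at section boundaries for the 400-line cap.
Imports ONLY the previous part and `HarnessLib`; no `set_option`, no `sorry`, no instance, no notation, no `private`, no `native_decide`.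
-/

namespace Summit.AtomisticToContinuum.Crystallization.Theorems.ChargedEnergyGapChartDial

/-! ## §S6 The W leaf (window): relaxed leg and parabola tests, convex in the step count -/

/-- the relaxed parabola functional `F(ν, x) = x² + ν·aL² + R2·ν(ν-1) - 2ν·aL·x` (all scaled). -/
def kcParF (R2 aL x ν : ℝ) : ℝ := x * x + ν * (aL * aL) + R2 * (ν * (ν - 1)) - 2 * ν * (aL * x)

/-- `kc_parfail_real` (docstring added by the landing lane; see the module docstring). [formal bookkeeping] -/
theorem kc_parfail_real {R2 aL sLo sHi tLo n : ℕ} (h : kcParFail R2 aL sLo sHi tLo n = true) (hn : 1 ≤ n) :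
    kcParF R2 aL sLo n < (tLo : ℝ) * tLo ∧ kcParF R2 aL sHi n < (tLo : ℝ) * tLo := by
  simp only [kcParFail, Bool.and_eq_true, decide_eq_true_eq] at h
  obtain ⟨h1, h2⟩ := h
  have hc : ((n - 1 : ℕ) : ℝ) = (n : ℝ) - 1 := by rw [Nat.cast_sub hn]; norm_num
  generalize hM : n - 1 = M at h1 h2 hc
  have h1' : (sLo : ℝ) * sLo + n * (aL * aL) + R2 * (n * M) < tLo * tLo + 2 * n * (aL * sLo) := by exact_mod_cast h1
  have h2' : (sHi : ℝ) * sHi + n * (aL * aL) + R2 * (n * M) < tLo * tLo + 2 * n * (aL * sHi) := by exact_mod_cast h2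
  rw [hc] at h1' h2'
  unfold kcParF
  exact ⟨by linarith only [h1'], by linarith only [h2']⟩

/-- `F` is convex in the step count: failing at `u` and at `v` it fails in between. -/
theorem kc_parF_between {R2 aL x T u v ν : ℝ} (hR : 0 ≤ R2) (hu : u ≤ ν) (hv : ν ≤ v) (h1 : kcParF R2 aL x u < T)
    (h2 : kcParF R2 aL x v < T) : kcParF R2 aL x ν < T := by
  have e : ∀ μ, kcParF R2 aL x μ = R2 * μ * μ + (aL * aL - R2 - 2 * (aL * x)) * μ + x * x := by
    intro μ; unfold kcParF; ring
  rw [e] at h1 h2 ⊢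
  exact lt_of_le_of_lt (kc_convex_max hR hu hv) (max_lt h1 h2)

/-- ★ a failing relaxed parabola test contradicts the true parabola inequality (convexity in the source depth). -/
theorem kc_par_contra {R2 aL sLo sHi tLo : ℕ} {ν X S T r : ℝ} (hf1 : kcParF R2 aL sLo ν < (tLo : ℝ) * tLo)
    (hf2 : kcParF R2 aL sHi ν < (tLo : ℝ) * tLo) (hν : 1 ≤ ν) (haL : (aL : ℝ) ≤ X) (hXS : X ≤ S) (hS1 : (sLo : ℝ) ≤ S)
    (hS2 : S ≤ sHi) (hT : (tLo : ℝ) ≤ T) (hr : r * r ≤ R2)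
    (hpar : T * T ≤ S * S - ν * (X * (2 * S - X)) + r * r * (ν * (ν - 1))) : False := by
  have haL0 : (0 : ℝ) ≤ aL := Nat.cast_nonneg _
  have htLo0 : (0 : ℝ) ≤ tLo := Nat.cast_nonneg _
  have h1 : (aL : ℝ) * (2 * S - aL) ≤ X * (2 * S - X) := kc_mono_sq haL0 haL hXS le_rfl
  have hνν : 0 ≤ ν * (ν - 1) := mul_nonneg (by linarith only [hν]) (by linarith only [hν])
  have h2 : r * r * (ν * (ν - 1)) ≤ (R2 : ℝ) * (ν * (ν - 1)) := mul_le_mul_of_nonneg_right hr hνν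
  have h3 : ν * ((aL : ℝ) * (2 * S - aL)) ≤ ν * (X * (2 * S - X)) := mul_le_mul_of_nonneg_left h1 (by linarith only [hν])
  have h4 : T * T ≤ kcParF R2 aL S ν := by unfold kcParF; linarith only [hpar, h2, h3]
  have e : ∀ x, kcParF R2 aL x ν = 1 * x * x + (-(2 * ν * aL)) * x + (ν * (aL * aL) + R2 * (ν * (ν - 1))) := by
    intro x; unfold kcParF; ring
  have h5 : kcParF R2 aL S ν < (tLo : ℝ) * tLo := by
    rw [e] at hf1 hf2 ⊢
    exact lt_of_le_of_lt (kc_convex_max (by norm_num) hS1 hS2) (max_lt hf1 hf2)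
  have h6 : (tLo : ℝ) * tLo ≤ T * T := mul_le_mul hT hT htLo0 (le_trans htLo0 hT)
  linarith only [h4, h5, h6]

/-- ★ a failing relaxed leg test at `nL ≥ ν` contradicts the true leg inequality at `ν`. -/
theorem kc_leg_contra {R2 aL elLo bR erLo nL : ℕ} (h : kcLegFail R2 aL elLo bR erLo nL = true) {ν X S Y T r : ℝ}
    (hν1 : 1 ≤ ν) (hν : ν ≤ nL) (haL : (aL : ℝ) ≤ X) (hXS : X ≤ S) (hS : (elLo : ℝ) ≤ S) (hbR : (bR : ℝ) ≤ Y)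
    (hYT : Y ≤ T) (hT : (erLo : ℝ) ≤ T) (hr : r * r ≤ R2)
    (hleg : X * (2 * S - X) + Y * (2 * T - Y) ≤ 2 * (r * r) * (ν - 1)) : False := by
  simp only [kcLegFail, decide_eq_true_eq] at h
  have hnL : 1 ≤ nL := by
    have : (1 : ℝ) ≤ nL := le_trans hν1 hν
    exact_mod_cast this
  have hc : ((nL - 1 : ℕ) : ℝ) = (nL : ℝ) - 1 := by rw [Nat.cast_sub hnL]; norm_num
  generalize hM : nL - 1 = M at h hc
  have h' : (2 : ℝ) * R2 * M + aL * aL + bR * bR < 2 * aL * elLo + 2 * bR * erLo := by exact_mod_cast h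
  rw [hc] at h'
  have h1 : (aL : ℝ) * (2 * elLo - aL) ≤ X * (2 * S - X) := kc_mono_sq (Nat.cast_nonneg _) haL hXS hS
  have h2 : (bR : ℝ) * (2 * erLo - bR) ≤ Y * (2 * T - Y) := kc_mono_sq (Nat.cast_nonneg _) hbR hYT hT
  have hR0 : (0 : ℝ) ≤ R2 := Nat.cast_nonneg _
  have h3 : 2 * (r * r) * (ν - 1) ≤ 2 * (R2 : ℝ) * (ν - 1) :=
    mul_le_mul_of_nonneg_right (by linarith only [hr]) (by linarith only [hν1])
  have h4 : 2 * (R2 : ℝ) * (ν - 1) ≤ 2 * (R2 : ℝ) * ((nL : ℝ) - 1) :=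
    mul_le_mul_of_nonneg_left (by linarith only [hν]) (by linarith only [hR0])
  linarith only [h', h1, h2, h3, h4, hleg]

/-- the scaled facts of one gap used by the W leaf: kink lower bounds, depth boxes, slope box, leg and the two parabolas. -/
structure KcGapFacts (R2 aL elLo elHi bR erLo erHi : ℕ) (n : ℕ) (X S Y T r : ℝ) : Prop where
  haL : (aL : ℝ) ≤ X
  hXS : X ≤ S
  hS1 : (elLo : ℝ) ≤ S
  hS2 : S ≤ elHi
  hbR : (bR : ℝ) ≤ Y
  hYT : Y ≤ T
  hT1 : (erLo : ℝ) ≤ T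
  hT2 : T ≤ erHi
  hr : r * r ≤ R2
  leg : X * (2 * S - X) + Y * (2 * T - Y) ≤ 2 * (r * r) * ((n : ℝ) - 1)
  parF : T * T ≤ S * S - (n : ℝ) * (X * (2 * S - X)) + r * r * ((n : ℝ) * ((n : ℝ) - 1))
  parB : S * S ≤ T * T - (n : ℝ) * (Y * (2 * T - Y)) + r * r * ((n : ℝ) * ((n : ℝ) - 1))

/-- the pieces leave no admissible even step count in `(pos, stop]`. -/
theorem kcPieces_false {R2 aL elLo elHi bR erLo erHi stop n : ℕ} {X S Y T r : ℝ}
    (hg : KcGapFacts R2 aL elLo elHi bR erLo erHi n X S Y T r) (hn2 : n % 2 = 0) (hns : n ≤ stop) :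
    ∀ (cov : List (ℕ × ℕ × Bool)) (pos : ℕ), kcPieces R2 aL elLo elHi bR erLo erHi stop pos cov = true →
      pos % 2 = 0 → pos < n → False
  | [], pos, h, hp, hpn => by
    simp only [kcPieces, decide_eq_true_eq] at h; omega
  | (u, v, f) :: rest, pos, h, hp, hpn => by
    simp only [kcPieces, Bool.or_eq_true, Bool.and_eq_true, decide_eq_true_eq] at h
    rcases h with h | ⟨⟨⟨⟨hu, huv⟩, hv2⟩, htest⟩, hrest⟩
    · omega
    rcases Nat.lt_or_ge v n with hnv | hnv
    · exact kcPieces_false hg hn2 hns rest v hrest hv2 hnv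
    · have hun : u ≤ n := by omega
      have hu1 : 1 ≤ u := by omega
      have hv1 : 1 ≤ v := by omega
      have hn1 : (1 : ℝ) ≤ n := by exact_mod_cast (show 1 ≤ n by omega)
      have hun' : (u : ℝ) ≤ n := by exact_mod_cast hun
      have hnv' : (n : ℝ) ≤ v := by exact_mod_cast hnv
      have hR0 : (0 : ℝ) ≤ R2 := Nat.cast_nonneg _
      cases f
      · simp only [cond_false, Bool.and_eq_true] at htest
        obtain ⟨pu, pv⟩ := htest
        have fu := kc_parfail_real pu hu1
        have fv := kc_parfail_real pv hv1
        exact kc_par_contra (kc_parF_between hR0 hun' hnv' fu.1 fv.1) (kc_parF_between hR0 hun' hnv' fu.2 fv.2) hn1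
          hg.hbR hg.hYT hg.hT1 hg.hT2 hg.hS1 hg.hr hg.parB
      · simp only [cond_true, Bool.and_eq_true] at htest
        obtain ⟨pu, pv⟩ := htest
        have fu := kc_parfail_real pu hu1
        have fv := kc_parfail_real pv hv1
        exact kc_par_contra (kc_parF_between hR0 hun' hnv' fu.1 fv.1) (kc_parF_between hR0 hun' hnv' fu.2 fv.2) hn1
          hg.haL hg.hXS hg.hS1 hg.hS2 hg.hT1 hg.hr hg.parF

/-- ★ a covered gap admits no admissible even step count `n ∈ [2, stop]`. -/
theorem kcCovered_false {R2 aL elLo elHi bR erLo erHi nL stop n : ℕ} {cov : List (ℕ × ℕ × Bool)} {X S Y T r : ℝ}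
    (h : kcCovered R2 aL elLo elHi bR erLo erHi nL cov stop = true) (hg : KcGapFacts R2 aL elLo elHi bR erLo erHi n X S Y T r)
    (hn2 : n % 2 = 0) (hn1 : 2 ≤ n) (hns : n ≤ stop) : False := by
  simp only [kcCovered, Bool.or_eq_true, Bool.and_eq_true, decide_eq_true_eq] at h
  rcases h with h | ⟨⟨hnL2, hleg⟩, hpieces⟩
  · omega
  rcases Nat.lt_or_ge nL n with hlt | hge
  · exact kcPieces_false hg hn2 hns cov nL hpieces hnL2 hlt
  · rcases hleg with hlt2 | hfail
    · omega
    · have hn1' : (1 : ℝ) ≤ n := by exact_mod_cast (show 1 ≤ n by omega)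
      have hge' : (n : ℝ) ≤ nL := by exact_mod_cast hge
      exact kc_leg_contra hfail hn1' hge' hg.haL hg.hXS hg.hS1 hg.hbR hg.hYT hg.hT1 hg.hr hg.leg

/-- `kc_scale_par` (docstring added by the landing lane; see the module docstring). [formal bookkeeping] -/
theorem kc_scale_par {n : ℕ} {a el er ρ : ℝ}
    (h : er ^ 2 ≤ el ^ 2 - (n : ℝ) * (a * (2 * el - a)) + ρ ^ 2 * n * ((n : ℝ) - 1)) :
    er * kcD * (er * kcD) ≤ el * kcD * (el * kcD) - (n : ℝ) * (a * kcD * (2 * (el * kcD) - a * kcD)) +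
      ρ * kcD * (ρ * kcD) * ((n : ℝ) * ((n : ℝ) - 1)) := by
  have hD2 : (0 : ℝ) ≤ (kcD : ℝ) * kcD := by positivity
  have := mul_le_mul_of_nonneg_right h hD2
  have e1 : er ^ 2 * ((kcD : ℝ) * kcD) = er * kcD * (er * kcD) := by ring
  have e2 : (el ^ 2 - (n : ℝ) * (a * (2 * el - a)) + ρ ^ 2 * n * ((n : ℝ) - 1)) * ((kcD : ℝ) * kcD) =
      el * kcD * (el * kcD) - (n : ℝ) * (a * kcD * (2 * (el * kcD) - a * kcD)) +
        ρ * kcD * (ρ * kcD) * ((n : ℝ) * ((n : ℝ) - 1)) := by ring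
  rw [e1, e2] at this
  exact this

/-- `kc_scale_leg` (docstring added by the landing lane; see the module docstring). [formal bookkeeping] -/
theorem kc_scale_leg {n : ℕ} {a el b er ρ : ℝ}
    (h : a * (2 * el - a) + b * (2 * er - b) ≤ 2 * ρ ^ 2 * ((n : ℝ) - 1)) :
    a * kcD * (2 * (el * kcD) - a * kcD) + b * kcD * (2 * (er * kcD) - b * kcD) ≤
      2 * (ρ * kcD * (ρ * kcD)) * ((n : ℝ) - 1) := by
  have hD2 : (0 : ℝ) ≤ (kcD : ℝ) * kcD := by positivity
  have := mul_le_mul_of_nonneg_right h hD2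
  have e1 : (a * (2 * el - a) + b * (2 * er - b)) * ((kcD : ℝ) * kcD) =
      a * kcD * (2 * (el * kcD) - a * kcD) + b * kcD * (2 * (er * kcD) - b * kcD) := by ring
  have e2 : 2 * ρ ^ 2 * ((n : ℝ) - 1) * ((kcD : ℝ) * kcD) = 2 * (ρ * kcD * (ρ * kcD)) * ((n : ℝ) - 1) := by ring
  rw [e1, e2] at this
  exact this

/-- ★ a W leaf admits no admissible configuration. -/
theorem kcLeafW_false {cs : KcCase} {s : KcS} {n1 nL₁ nL₂ : ℕ} {cov₁ cov₂ : List (ℕ × ℕ × Bool)}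
    (h : kcLeafW s n1 nL₁ cov₁ nL₂ cov₂ = true) {q : KcConf} (hq : q.Adm cs) (hs : s.mem q) : False := by
  have hD := kcD_pos
  simp only [kcLeafW, Bool.and_eq_true, decide_eq_true_eq] at h
  obtain ⟨⟨⟨⟨hr0, hn1e⟩, hn12⟩, hc1⟩, hc2⟩ := h
  obtain ⟨hy1, hy2, hy3, hev1, hev2, hn1, hn2, hwin, hleg1, hleg2, hp1, hp2, hp3, hp4⟩ := hq
  obtain ⟨hr1, hr2, ⟨x1, x2, x3, x4, x5, x6, x7⟩, ⟨y1, y2, y3, y4, y5, y6, y7⟩, ⟨z1, z2, z3, z4, z5, z6, z7⟩⟩ := hs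
  obtain ⟨ha1, _, _, _, _, _, hm12, _, hm14, _⟩ := hy1
  obtain ⟨ha2, _, hb2, _, _, _, hm22, hm23, hm24, _⟩ := hy2
  obtain ⟨_, _, hb3, _, _, _, _, hm33, hm34, _⟩ := hy3
  have hN : q.n₁ + q.n₂ ≤ kcNmax s.rlo :=
    kc_le_nmax hr0 hr1 (Even.add hev1 hev2) (by push_cast; exact hwin)
  have hρD0 : 0 < q.ρ * kcD := lt_of_lt_of_le (by exact_mod_cast hr0) hr1
  have hρ2 : (q.ρ * kcD) * (q.ρ * kcD) ≤ ((s.rhi * s.rhi : ℕ) : ℝ) := by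
    push_cast; exact mul_le_mul hr2 hr2 hρD0.le (Nat.cast_nonneg _)
  have g1 : KcGapFacts (s.rhi * s.rhi) s.h₁.alo s.h₁.elo s.h₁.ehi s.h₂.blo s.h₂.elo s.h₂.ehi q.n₁
      (q.a₁ * kcD) (q.e₁ * kcD) (q.b₂ * kcD) (q.e₂ * kcD) (q.ρ * kcD) :=
    { haL := x1, hXS := mul_le_mul_of_nonneg_right (by linarith only [hm12, hm14]) hD.le, hS1 := x6, hS2 := x7,
      hbR := y3, hYT := mul_le_mul_of_nonneg_right (by linarith only [hm23, hm24]) hD.le, hT1 := y6, hT2 := y7,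
      hr := hρ2, leg := kc_scale_leg hleg1, parF := kc_scale_par hp1, parB := kc_scale_par hp2 }
  have g2 : KcGapFacts (s.rhi * s.rhi) s.h₂.alo s.h₂.elo s.h₂.ehi s.h₃.blo s.h₃.elo s.h₃.ehi q.n₂
      (q.a₂ * kcD) (q.e₂ * kcD) (q.b₃ * kcD) (q.e₃ * kcD) (q.ρ * kcD) :=
    { haL := y1, hXS := mul_le_mul_of_nonneg_right (by linarith only [hm22, hm24]) hD.le, hS1 := y6, hS2 := y7,
      hbR := z3, hYT := mul_le_mul_of_nonneg_right (by linarith only [hm33, hm34]) hD.le, hT1 := z6, hT2 := z7,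
      hr := hρ2, leg := kc_scale_leg hleg2, parF := kc_scale_par hp3, parB := kc_scale_par hp4 }
  have he1 := Nat.even_iff.1 hev1
  have he2 := Nat.even_iff.1 hev2
  rcases Nat.lt_or_ge q.n₁ n1 with hlt | hge
  · exact kcCovered_false hc1 g1 he1 (by omega) (by omega)
  · exact kcCovered_false hc2 g2 he2 (by omega) (by omega)


/-! ## §S7 The C leaf (charge budget) -/

/-- the scaled missing-row depth of a member hole lies in `[elo - ρhi, ehi - mx]`. -/
theorem kc_mD_bounds {t : ℕ} {h : KcH} {rhi : ℕ} {ρ e m a b : ℝ} (hy : KcHyp t ρ e m a b) (hr : ρ * kcD ≤ rhi)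
    (hm : h.mem e a b) : ((h.elo : ℝ) - rhi ≤ m * kcD) ∧ (m * kcD ≤ (h.ehi : ℝ) - h.mx) ∧ 187 / 2 * kcD ≤ m * kcD ∧
      m * kcD < 140 * kcD := by
  have hD := kcD_pos
  obtain ⟨_, _, _, _, _, hm1, hm2, hm3, hm4, hm5⟩ := hy
  obtain ⟨_, _, _, _, x5, x6, x7⟩ := hm
  have h1 : (e - ρ) * kcD ≤ m * kcD := mul_le_mul_of_nonneg_right hm1 hD.le
  have h2 : m * kcD ≤ (e - max a b) * kcD := mul_le_mul_of_nonneg_right (by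
    rcases le_total a b with hab | hab
    · rw [max_eq_right hab]; exact hm3
    · rw [max_eq_left hab]; exact hm2) hD.le
  refine ⟨by linarith only [h1, x6, hr], by linarith only [h2, x5, x7], mul_le_mul_of_nonneg_right hm4 hD.le,
    mul_lt_mul_of_pos_right hm5 hD⟩

/-- `kc_holeInfeasible_false` (docstring added by the landing lane; see the module docstring). [formal bookkeeping] -/
theorem kc_holeInfeasible_false {t : ℕ} {h : KcH} {rhi : ℕ} {ρ e m a b : ℝ} (hc : kcHoleInfeasible rhi h = true)
    (hy : KcHyp t ρ e m a b) (hr : ρ * kcD ≤ rhi) (hm : h.mem e a b) : False := by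
  obtain ⟨b1, b2, b3, b4⟩ := kc_mD_bounds hy hr hm
  simp only [kcHoleInfeasible, Bool.or_eq_true, decide_eq_true_eq] at hc
  rcases hc with hc | hc
  · have h1 : (((h.ehi - h.mx : ℕ)) : ℝ) < kcEMIN := by exact_mod_cast hc
    rw [kcEMIN_eq] at h1
    have h2 := kc_le_cast_tsub b2
    linarith only [h1, h2, b3]
  · have hpos : 0 < h.elo - rhi := lt_of_lt_of_le (by decide) hc
    have hle : rhi ≤ h.elo := by omega
    have h1 : ((kcETOP : ℕ) : ℝ) ≤ ((h.elo - rhi : ℕ) : ℝ) := by exact_mod_cast hc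
    rw [kcETOP_eq, Nat.cast_sub hle] at h1
    linarith only [h1, b1, b4]

/-- `kc_holeRange_sound` (docstring added by the landing lane; see the module docstring). [formal bookkeeping] -/
theorem kc_holeRange_sound {t : ℕ} {h : KcH} {rhi rA rB : ℕ} {ρ e m a b : ℝ} (hc : kcHoleRange rhi h rA rB = true)
    (hy : KcHyp t ρ e m a b) (hr : ρ * kcD ≤ rhi) (hm : h.mem e a b) :
    rA ≤ capKRow m ∧ capKRow m ≤ rB ∧ rB ≤ 74 := by
  obtain ⟨b1, b2, b3, b4⟩ := kc_mD_bounds hy hr hm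
  obtain ⟨_, _, _, _, _, _, _, _, hm4, hm5⟩ := hy
  obtain ⟨hR1, hR74, hlo, hhi⟩ := kc_row_cell hm4 hm5
  simp only [kcHoleRange, Bool.and_eq_true, Bool.or_eq_true, decide_eq_true_eq] at hc
  obtain ⟨⟨⟨⟨hA1, hAB⟩, hB74⟩, hA⟩, hB⟩ := hc
  refine ⟨?_, ?_, hB74⟩
  · rcases hA with hA | hA
    · omega
    · by_contra hlt
      rw [not_le] at hlt
      have hmono := kc_RHi_mono (show capKRow m ≤ rA - 1 by omega)
      have h1 : ((kcRHi (rA - 1) : ℕ) : ℝ) ≤ ((h.elo - rhi : ℕ) : ℝ) := by exact_mod_cast hA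
      have h2 : ((h.elo - rhi : ℕ) : ℝ) ≤ m * kcD := kc_cast_tsub_le (by linarith only [b3, kcD_pos]) b1
      have h3 : ((kcRHi (capKRow m) : ℕ) : ℝ) ≤ kcRHi (rA - 1) := by exact_mod_cast hmono
      linarith only [h1, h2, h3, hhi]
  · rcases hB with hB | hB
    · omega
    · by_contra hlt
      rw [not_le] at hlt
      have hmono := kc_RLo_mono (show rB + 1 ≤ capKRow m by omega)
      have h1 : ((h.ehi - h.mx : ℕ) : ℝ) < ((kcRLo (rB + 1) : ℕ) : ℝ) := by exact_mod_cast hB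
      have h2 : m * kcD ≤ ((h.ehi - h.mx : ℕ) : ℝ) := kc_le_cast_tsub b2
      have h3 : ((kcRLo (rB + 1) : ℕ) : ℝ) ≤ kcRLo (capKRow m) := by exact_mod_cast hmono
      linarith only [h1, h2, h3, hlo]

/-- ★ a C leaf bounds the two non-key table charges. -/
theorem kcLeafC_sound {c c' E10 rhi rA rB rA' rB' t t' : ℕ} {h h' : KcH} (hck : kcLeafC c c' E10 rhi h h' rA rB rA' rB' = true)
    (hc : c ≤ 12) (hc' : c' ≤ 12) {ρ e m a b e' m' a' b' : ℝ} (hy : KcHyp t ρ e m a b) (hy' : KcHyp t' ρ e' m' a' b')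
    (hr : ρ * kcD ≤ rhi) (hm : h.mem e a b) (hm' : h'.mem e' a' b') :
    kcTabR (capKRow m) c + kcTabR (capKRow m') c' ≤ (E10 : ℝ) / 10 := by
  simp only [kcLeafC, Bool.or_eq_true, Bool.and_eq_true, decide_eq_true_eq] at hck
  rcases hck with (⟨-, hinf⟩ | ⟨-, hinf⟩) | ⟨⟨hR, hR'⟩, hsum⟩
  · exact (kc_holeInfeasible_false hinf hy hr hm).elim
  · exact (kc_holeInfeasible_false hinf hy' hr hm').elim
  obtain ⟨r1, r2, r3⟩ := kc_holeRange_sound hR hy hr hm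
  obtain ⟨r1', r2', r3'⟩ := kc_holeRange_sound hR' hy' hr hm'
  have t1 := kc_rangeMax_ge c rA (rB + 1 - rA) (capKRow m) r1 (by omega)
  have t2 := kc_rangeMax_ge c' rA' (rB' + 1 - rA') (capKRow m') r1' (by omega)
  have hs : ((kcTab10 (capKRow m) c : ℕ) : ℝ) + kcTab10 (capKRow m') c' ≤ E10 := by
    have : kcTab10 (capKRow m) c + kcTab10 (capKRow m') c' ≤ E10 := le_trans (Nat.add_le_add t1 t2) hsum
    exact_mod_cast this
  rw [kc_tab10 (by omega) hc, kc_tab10 (by omega) hc'] at hs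
  unfold kcTabR
  linarith only [hs]

/-! ## §S8 ★ Soundness of the checker -/

/-- ★★ SOUNDNESS: a certified state contains no admissible configuration violating the clause of the case. -/
theorem kcCheck_sound {cs : KcCase} (hv : cs.Valid) :
    ∀ (T : KcT) (s : KcS), kcCheck cs T s = true → ∀ q : KcConf, q.Adm cs → s.mem q → KcGoal cs q
  | .C rA rB rA' rB', s, h, q, hq, hs => by
    obtain ⟨hy1, hy2, hy3, -⟩ := hq
    obtain ⟨-, hr2, hm1, hm2, hm3⟩ := hs
    obtain ⟨-, -, -, hc1, hc2, hc3⟩ := hv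
    simp only [kcCheck] at h
    unfold KcGoal
    by_cases hp : cs.p = 1
    · rw [if_pos hp] at h ⊢
      exact kcLeafC_sound h hc2 hc3 hy2 hy3 hr2 hm2 hm3
    · rw [if_neg hp] at h ⊢
      exact kcLeafC_sound h hc1 hc3 hy1 hy3 hr2 hm1 hm3
  | .L, s, h, q, hq, hs => by
    simp only [kcCheck] at h
    exact (kcLeafL_false hv h hq hs).elim
  | .W n1 nL₁ cov₁ nL₂ cov₂, s, h, q, hq, hs => by
    simp only [kcCheck] at h
    exact (kcLeafW_false (cs := cs) h hq hs).elim
  | .S ax tl th, s, h, q, hq, hs => by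
    simp only [kcCheck, Bool.and_eq_true] at h
    rcases kcSplit_mem hv hq hs ax with hm | hm
    · exact kcCheck_sound hv tl _ h.1 q hq hm
    · exact kcCheck_sound hv th _ h.2 q hq hm

/-- ★★ the driver: a certificate checked from the root decides the clause for every admissible configuration with
`ρ·D ∈ [rlo, rhi]`. -/
theorem kc_case_sound {cs : KcCase} (hv : cs.Valid) {T : KcT} {rlo rhi : ℕ}
    (h : kcCheck cs T (kcRoot cs rlo rhi) = true) (q : KcConf) (hq : q.Adm cs)
    (hr : (rlo : ℝ) ≤ q.ρ * kcD ∧ q.ρ * kcD ≤ rhi) : KcGoal cs q :=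
  kcCheck_sound hv T _ h q hq (kcRoot_mem hv hq hr)

end Summit.AtomisticToContinuum.Crystallization.Theorems.ChargedEnergyGapChartDial
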